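import Mathlib
import Literature.Barriers.ValiantsHypothesis.GCTMatrixPoweringGrenet

/-!
# Crux `DetQP.DetqpSuperquadratic` (stmt-ValiantsHypothesis-0318), line `linear-homogenisation-transfer` —
stub `stub_traceUnrolling` (S2): linear homogenisation of a Krylov normal form (the `ζ`-twin)

The line reduces the crux `dc(per_n) ≥ n^{2+ε}` to a width statement about Krylov normal forms
`f = ρᵀ L^{n-2} γ` (`ρ, γ ∈ (S¹)^w`, `L ∈ M_w(S¹)` homogeneous LINEAR, `ρᵀ Lʲ γ = 0` for
`j < n - 2`).  This file proves stub S2 of that line, for an arbitrary polynomial `f` over `ℂ` in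
arbitrary variables `σ` and every `n ≥ 2`:

* `stub_traceUnrolling` : such a Krylov form of width `w` for `f` gives
  `HasPowTraceRepr ℂ f n (2 * w + 1)`, i.e. `f = tr(𝕄ⁿ)` for a `(2w+1) × (2w+1)` matrix `𝕄` of
  homogeneous linear forms (the homogeneous matrix-powering model of Gesmundo–Ikenmeyer–Panova,
  `Literature.Barriers.ValiantsHypothesis.HasPowTraceRepr`).

**Proof.**  Let `M = [[0, ρᵀ], [γ, L]]` (`Matrix.fromBlocks 0 (replicateRow Unit ρ)
(replicateCol Unit γ) L`, indexed by `Unit ⊕ Fin w`; the lemmas below take `M` together with the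
hypothesis `hM : M = …`).  The heart is the closed-walk identity
`TraceUnrolling.trace_bordered_pow`, valid over any commutative ring and using only the vanishing
of the low Markov parameters `ρᵀ Lʲ γ = 0` (`j + 2 < n`):

  `tr(Mⁿ) = tr(Lⁿ) + n · ρᵀ L^{n-2} γ`.

It is obtained from the block recurrences for `M^{k+1} = M^k · M` (`blocks_pow_succ`): the top
blocks of `M^{k+1}` are `0` and `ρᵀ L^k` as long as `k + 2 ≤ n` (`topBlocks_pow`), the bottom-right
block satisfies `(M^k)₂₂ Lʲ γ = L^{k+j} γ` for `k + j + 2 ≤ n` (`botBlock_pow_mul`), and the excess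
`E_k = (M^k)₂₂ - L^k` obeys `E_{m+2} = (M^m)₂₂ γ ρᵀ + E_{m+1} L` (`excess_succ_succ`), whence by
cyclicity of the trace `tr(E_{m+1} Lʲ) = m · ρᵀ L^{n-2} γ` for `m + 1 + j = n`
(`trace_excess_mul_pow`); finally `tr(Mⁿ) = tr((Mⁿ)₁₁) + tr((Mⁿ)₂₂) = p + (tr Lⁿ + (n-1) p)` with
`p = ρᵀ L^{n-2} γ`.  The twin: with `ζⁿ = -1` and `cⁿ · n = 1` (`IsAlgClosed.exists_pow_nat_eq`
in `ℂ`) put `𝕄 = c · (M ⊕ ζ L)`; then `tr(𝕄ⁿ) = cⁿ (tr Mⁿ + ζⁿ tr Lⁿ) = cⁿ · n · f = f`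
(`trace_twin_pow`), all entries of `𝕄` are homogeneous of degree `1` (`twin_isHomogeneous`;
`0` is homogeneous of every degree), and `𝕄` is reindexed along
`Fin (2w+1) ≃ (Unit ⊕ Fin w) ⊕ Fin w` (`hasPowTraceRepr_of_equiv`; powers and traces commute with
reindexing: `Grenet.submatrix_pow_equiv`, `Grenet.trace_submatrix_equiv`).

Consequence used by the skeleton: `pc(per_n) + 1 ≤ 2 · dc(per_n)` once the Krylov normal form of
`per_n` of width `dc(per_n) - 1` is available (stubs S1a/S1b of the same line, not in this file).
No new definitions; self-contained on Mathlib and the Literature entry `GCTMatrixPowering(Grenet)`.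
-/

noncomputable section

-- `Summit.ValiantsHypothesis.ValiantsHypothesis.…` is the tree's mandated single-conjunct layout
-- (Sub = Summit), so the duplicated namespace component is intended.
set_option linter.dupNamespace false

namespace Summit.ValiantsHypothesis.ValiantsHypothesis.Theorems.DetQPDetqpSuperquadratic

open MvPolynomial Matrix
open Literature.Barriers.ValiantsHypothesis (HasPowTraceRepr)

namespace TraceUnrolling

section Ring

variable {R : Type*} [CommRing R] {w : ℕ}

/-- `ρᵀ · X · γ` as a `Unit × Unit` matrix is the scalar `ρ ⬝ᵥ (X *ᵥ γ)`. [folklore] -/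
theorem row_mul_mul_col (ρ γ : Fin w → R) (X : Matrix (Fin w) (Fin w) R) :
    replicateRow Unit ρ * X * replicateCol Unit γ = Matrix.of fun _ _ => ρ ⬝ᵥ (X *ᵥ γ) := by
  ext i j
  simp only [Matrix.mul_apply, Matrix.replicateRow_apply, Matrix.replicateCol_apply,
    Matrix.of_apply, dotProduct, Matrix.mulVec, Finset.sum_mul, Finset.mul_sum]
  rw [Finset.sum_comm]
  refine Finset.sum_congr rfl fun k _ => Finset.sum_congr rfl fun l _ => ?_
  ring

/-- The trace of the constant `Unit × Unit` matrix `(p)` is `p`. [folklore] -/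
theorem trace_of_unit (p : R) : (Matrix.of fun (_ : Unit) (_ : Unit) => p).trace = p := by
  simp [Matrix.trace]

/-- The bottom blocks of the identity matrix on `Unit ⊕ Fin w`: `1₂₂ = 1` and `1₂₁ = 0`.
[folklore] -/
theorem toBlocks_one :
    (1 : Matrix (Unit ⊕ Fin w) (Unit ⊕ Fin w) R).toBlocks₂₂ = 1 ∧
    (1 : Matrix (Unit ⊕ Fin w) (Unit ⊕ Fin w) R).toBlocks₂₁ = 0 := by
  constructor
  · conv_lhs => rw [← Matrix.fromBlocks_one]
    rw [Matrix.toBlocks_fromBlocks₂₂]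
  · conv_lhs => rw [← Matrix.fromBlocks_one]
    rw [Matrix.toBlocks_fromBlocks₂₁]

/-- The vanishing hypothesis `ρᵀ Lʲ γ = 0` (`j + 2 < n`) in matrix form: `ρᵀ · Lʲ · γ = 0`.
[folklore] -/
theorem row_pow_col_eq_zero {ρ γ : Fin w → R} {L : Matrix (Fin w) (Fin w) R} {n : ℕ}
    (hvan : ∀ j : ℕ, j + 2 < n → ρ ⬝ᵥ (L ^ j *ᵥ γ) = 0) {j : ℕ} (hj : j + 2 < n) :
    replicateRow Unit ρ * L ^ j * replicateCol Unit γ = 0 := by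
  rw [row_mul_mul_col, hvan j hj]
  ext i j
  simp

/-! From here on `M = [[0, ρᵀ], [γ, L]]` is the bordered matrix, carried as the hypothesis `hM`. -/

variable {ρ γ : Fin w → R} {L : Matrix (Fin w) (Fin w) R}
  {M : Matrix (Unit ⊕ Fin w) (Unit ⊕ Fin w) R}
  (hM : M = Matrix.fromBlocks 0 (replicateRow Unit ρ) (replicateCol Unit γ) L)
include hM

/-- Block recurrences for the powers of the bordered matrix `M = [[0, ρᵀ], [γ, L]]`, read off from
`M^{k+1} = M^k · M`: `(M^{k+1})₁₁ = (M^k)₁₂ γ`, `(M^{k+1})₁₂ = (M^k)₁₁ ρᵀ + (M^k)₁₂ L`,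
`(M^{k+1})₂₁ = (M^k)₂₂ γ`, `(M^{k+1})₂₂ = (M^k)₂₁ ρᵀ + (M^k)₂₂ L`. [folklore] -/
theorem blocks_pow_succ (k : ℕ) :
    (M ^ (k + 1)).toBlocks₁₁ = (M ^ k).toBlocks₁₂ * replicateCol Unit γ ∧
    (M ^ (k + 1)).toBlocks₁₂ = (M ^ k).toBlocks₁₁ * replicateRow Unit ρ + (M ^ k).toBlocks₁₂ * L ∧
    (M ^ (k + 1)).toBlocks₂₁ = (M ^ k).toBlocks₂₂ * replicateCol Unit γ ∧
    (M ^ (k + 1)).toBlocks₂₂ =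
      (M ^ k).toBlocks₂₁ * replicateRow Unit ρ + (M ^ k).toBlocks₂₂ * L := by
  have h : M ^ (k + 1) =
      Matrix.fromBlocks ((M ^ k).toBlocks₁₂ * replicateCol Unit γ)
        ((M ^ k).toBlocks₁₁ * replicateRow Unit ρ + (M ^ k).toBlocks₁₂ * L)
        ((M ^ k).toBlocks₂₂ * replicateCol Unit γ)
        ((M ^ k).toBlocks₂₁ * replicateRow Unit ρ + (M ^ k).toBlocks₂₂ * L) := by
    calc M ^ (k + 1)
        = Matrix.fromBlocks (M ^ k).toBlocks₁₁ (M ^ k).toBlocks₁₂ (M ^ k).toBlocks₂₁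
            (M ^ k).toBlocks₂₂ *
          Matrix.fromBlocks 0 (replicateRow Unit ρ) (replicateCol Unit γ) L := by
          rw [Matrix.fromBlocks_toBlocks, ← hM, pow_succ]
      _ = _ := by
          rw [Matrix.fromBlocks_multiply]
          simp only [Matrix.mul_zero, zero_add]
  refine ⟨?_, ?_, ?_, ?_⟩
  · conv_lhs => rw [h]
    rw [Matrix.toBlocks_fromBlocks₁₁]
  · conv_lhs => rw [h]
    rw [Matrix.toBlocks_fromBlocks₁₂]
  · conv_lhs => rw [h]
    rw [Matrix.toBlocks_fromBlocks₂₁]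
  · conv_lhs => rw [h]
    rw [Matrix.toBlocks_fromBlocks₂₂]

/-- Claim 1: for `k + 2 ≤ n`, the top blocks of `M^{k+1}` are `(M^{k+1})₁₁ = 0` and
`(M^{k+1})₁₂ = ρᵀ L^k`. [folklore] -/
theorem topBlocks_pow {n : ℕ} (hvan : ∀ j : ℕ, j + 2 < n → ρ ⬝ᵥ (L ^ j *ᵥ γ) = 0) :
    ∀ k : ℕ, k + 2 ≤ n →
      (M ^ (k + 1)).toBlocks₁₁ = 0 ∧ (M ^ (k + 1)).toBlocks₁₂ = replicateRow Unit ρ * L ^ k := by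
  intro k
  induction k with
  | zero =>
    intro _
    rw [zero_add, pow_one, pow_zero, Matrix.mul_one, hM]
    exact ⟨Matrix.toBlocks_fromBlocks₁₁ _ _ _ _, Matrix.toBlocks_fromBlocks₁₂ _ _ _ _⟩
  | succ k ih =>
    intro hk
    obtain ⟨h11, h12⟩ := ih (by omega)
    obtain ⟨e11, e12, -, -⟩ := blocks_pow_succ hM (k + 1)
    refine ⟨?_, ?_⟩
    · rw [e11, h12]
      exact row_pow_col_eq_zero hvan (by omega)
    · rw [e12, h11, h12, Matrix.zero_mul, zero_add, Matrix.mul_assoc, ← pow_succ]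

/-- Claim 2: for `k + j + 2 ≤ n`, `(M^k)₂₂ Lʲ γ = L^{k+j} γ`. [folklore] -/
theorem botBlock_pow_mul {n : ℕ} (hvan : ∀ j : ℕ, j + 2 < n → ρ ⬝ᵥ (L ^ j *ᵥ γ) = 0) :
    ∀ k j : ℕ, k + j + 2 ≤ n →
      (M ^ k).toBlocks₂₂ * L ^ j * replicateCol Unit γ = L ^ (k + j) * replicateCol Unit γ := by
  intro k
  induction k with
  | zero =>
    intro j _
    rw [pow_zero, (toBlocks_one (R := R) (w := w)).1, Matrix.one_mul, zero_add]
  | succ k ih =>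
    intro j hkj
    obtain ⟨-, -, -, e22⟩ := blocks_pow_succ hM k
    rw [e22, Matrix.add_mul, Matrix.add_mul]
    have h1 : (M ^ k).toBlocks₂₁ * replicateRow Unit ρ * L ^ j * replicateCol Unit γ = 0 := by
      rw [Matrix.mul_assoc, Matrix.mul_assoc, ← Matrix.mul_assoc (replicateRow Unit ρ),
        row_pow_col_eq_zero hvan (by omega), Matrix.mul_zero]
    have h2 : (M ^ k).toBlocks₂₂ * L * L ^ j * replicateCol Unit γ =
        L ^ (k + 1 + j) * replicateCol Unit γ := by
      rw [Matrix.mul_assoc _ L, ← pow_succ', ih (j + 1) (by omega)]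
      congr 1
      ring_nf
    rw [h1, h2, zero_add]

/-- The excess `E_k := (M^k)₂₂ - L^k` vanishes for `k = 1`. [folklore] -/
theorem excess_one : (M ^ 1).toBlocks₂₂ - L ^ 1 = 0 := by
  rw [pow_one, pow_one, hM, Matrix.toBlocks_fromBlocks₂₂, sub_self]

/-- The recurrence `E_{m+2} = (M^m)₂₂ γ ρᵀ + E_{m+1} L` for the excess `E_k := (M^k)₂₂ - L^k`.
[folklore] -/
theorem excess_succ_succ (m : ℕ) :
    (M ^ (m + 2)).toBlocks₂₂ - L ^ (m + 2) =
      (M ^ m).toBlocks₂₂ * replicateCol Unit γ * replicateRow Unit ρ +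
        ((M ^ (m + 1)).toBlocks₂₂ - L ^ (m + 1)) * L := by
  obtain ⟨-, -, -, e22⟩ := blocks_pow_succ hM (m + 1)
  obtain ⟨-, -, e21, -⟩ := blocks_pow_succ hM m
  rw [show m + 2 = m + 1 + 1 from rfl, e22, e21, Matrix.sub_mul, pow_succ L (m + 1)]
  abel

/-- Claim 3: `tr(E_{m+1} Lʲ) = m · ρᵀ L^{n-2} γ` whenever `m + 1 + j = n`, for the excess
`E_k := (M^k)₂₂ - L^k` (cyclicity of the trace and Claim 2). [folklore] -/
theorem trace_excess_mul_pow {n : ℕ} (hvan : ∀ j : ℕ, j + 2 < n → ρ ⬝ᵥ (L ^ j *ᵥ γ) = 0) :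
    ∀ m j : ℕ, m + 1 + j = n →
      (((M ^ (m + 1)).toBlocks₂₂ - L ^ (m + 1)) * L ^ j).trace =
        m * (ρ ⬝ᵥ (L ^ (n - 2) *ᵥ γ)) := by
  intro m
  induction m with
  | zero =>
    intro j _
    rw [zero_add, excess_one hM, Matrix.zero_mul, Matrix.trace_zero, Nat.cast_zero, zero_mul]
  | succ m ih =>
    intro j hmj
    rw [show m + 1 + 1 = m + 2 from rfl, excess_succ_succ hM, Matrix.add_mul, Matrix.trace_add,
      Matrix.mul_assoc ((M ^ (m + 1)).toBlocks₂₂ - L ^ (m + 1)) L, ← pow_succ',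
      ih (j + 1) (by omega)]
    have hcyc : ((M ^ m).toBlocks₂₂ * replicateCol Unit γ * replicateRow Unit ρ * L ^ j).trace =
        (replicateRow Unit ρ * L ^ j *
          ((M ^ m).toBlocks₂₂ * L ^ 0 * replicateCol Unit γ)).trace := by
      rw [pow_zero, Matrix.mul_one, Matrix.mul_assoc _ (replicateRow Unit ρ),
        Matrix.trace_mul_comm, Matrix.mul_assoc]
    rw [hcyc, botBlock_pow_mul hM hvan m 0 (by omega), add_zero, ← Matrix.mul_assoc,
      Matrix.mul_assoc (replicateRow Unit ρ), ← pow_add, show j + m = n - 2 by omega,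
      row_mul_mul_col, trace_of_unit]
    push_cast
    ring

/-- **The closed-walk identity.** For `n ≥ 2` and `ρᵀ Lʲ γ = 0` whenever `j + 2 < n`:
`tr(Mⁿ) = tr(Lⁿ) + n · ρᵀ L^{n-2} γ` for the bordered matrix `M = [[0, ρᵀ], [γ, L]]`.
[folklore] -/
theorem trace_bordered_pow {n : ℕ} (hn : 2 ≤ n)
    (hvan : ∀ j : ℕ, j + 2 < n → ρ ⬝ᵥ (L ^ j *ᵥ γ) = 0) :
    (M ^ n).trace = (L ^ n).trace + n * (ρ ⬝ᵥ (L ^ (n - 2) *ᵥ γ)) := by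
  obtain ⟨m, rfl⟩ : ∃ m, n = m + 2 := ⟨n - 2, by omega⟩
  have htr : (M ^ (m + 2)).trace =
      ((M ^ (m + 2)).toBlocks₁₁).trace + ((M ^ (m + 2)).toBlocks₂₂).trace := by
    simp [Matrix.trace, Fintype.sum_sum_type, Matrix.toBlocks₁₁, Matrix.toBlocks₂₂]
  -- top-left block: `ρᵀ L^m γ = p`
  obtain ⟨e11, -, -, -⟩ := blocks_pow_succ hM (m + 1)
  obtain ⟨-, h12⟩ := topBlocks_pow hM hvan m (by omega)
  have h11 : ((M ^ (m + 2)).toBlocks₁₁).trace = ρ ⬝ᵥ (L ^ m *ᵥ γ) := by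
    rw [show m + 2 = m + 1 + 1 from rfl, e11, h12, row_mul_mul_col, trace_of_unit]
  -- bottom-right block: `E_{m+2} + L^{m+2}`
  have h22 : ((M ^ (m + 2)).toBlocks₂₂).trace =
      (L ^ (m + 2)).trace + (m + 1 : ℕ) * (ρ ⬝ᵥ (L ^ m *ᵥ γ)) := by
    have := trace_excess_mul_pow hM hvan (m + 1) 0 (by omega)
    rw [pow_zero, Matrix.mul_one, show m + 1 + 1 = m + 2 from rfl,
      show m + 2 - 2 = m from rfl] at this
    rw [(sub_add_cancel ((M ^ (m + 2)).toBlocks₂₂) (L ^ (m + 2))).symm, Matrix.trace_add, this,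
      add_comm]
  rw [htr, h11, h22, show m + 2 - 2 = m from rfl]
  push_cast
  ring

end Ring

section Twin

variable {k : Type*} [CommRing k] {σ : Type*} {w : ℕ}

/-- The entries of the twin `c · (M ⊕ ζ L)` of the bordered matrix `M = [[0, ρᵀ], [γ, L]]` are
homogeneous of degree `1` when those of `ρ, γ, L` are (`0` is homogeneous of every degree;
scalars preserve homogeneity). [folklore] -/
theorem twin_isHomogeneous {ρ γ : Fin w → MvPolynomial σ k}
    {L : Matrix (Fin w) (Fin w) (MvPolynomial σ k)}
    {M : Matrix (Unit ⊕ Fin w) (Unit ⊕ Fin w) (MvPolynomial σ k)}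
    (hM : M = Matrix.fromBlocks 0 (replicateRow Unit ρ) (replicateCol Unit γ) L)
    (hρ : ∀ i, (ρ i).IsHomogeneous 1) (hγ : ∀ i, (γ i).IsHomogeneous 1)
    (hL : ∀ i j, (L i j).IsHomogeneous 1) (ζ c : k) (i j : (Unit ⊕ Fin w) ⊕ Fin w) :
    ((c • Matrix.fromBlocks M 0 0 (ζ • L)) i j).IsHomogeneous 1 := by
  subst hM
  rw [Matrix.smul_apply, MvPolynomial.smul_eq_C_mul]
  refine MvPolynomial.IsHomogeneous.C_mul ?_ c
  rcases i with (_ | a) | a <;> rcases j with (_ | b) | b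
  · rw [Matrix.fromBlocks_apply₁₁, Matrix.fromBlocks_apply₁₁]; exact isHomogeneous_zero _ _ _
  · rw [Matrix.fromBlocks_apply₁₁, Matrix.fromBlocks_apply₁₂, Matrix.replicateRow_apply]
    exact hρ b
  · rw [Matrix.fromBlocks_apply₁₂]; exact isHomogeneous_zero _ _ _
  · rw [Matrix.fromBlocks_apply₁₁, Matrix.fromBlocks_apply₂₁, Matrix.replicateCol_apply]
    exact hγ a
  · rw [Matrix.fromBlocks_apply₁₁, Matrix.fromBlocks_apply₂₂]; exact hL a b
  · rw [Matrix.fromBlocks_apply₁₂]; exact isHomogeneous_zero _ _ _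
  · rw [Matrix.fromBlocks_apply₂₁]; exact isHomogeneous_zero _ _ _
  · rw [Matrix.fromBlocks_apply₂₁]; exact isHomogeneous_zero _ _ _
  · rw [Matrix.fromBlocks_apply₂₂, Matrix.smul_apply, MvPolynomial.smul_eq_C_mul]
    exact (hL a b).C_mul ζ

/-- The twin computes `f`: if `tr(Mⁿ) = tr(Lⁿ) + n · f`, `ζⁿ = -1` and `cⁿ · n = 1`, then
`tr((c · (M ⊕ ζ L))ⁿ) = cⁿ · (tr Mⁿ + ζⁿ tr Lⁿ) = cⁿ · n · f = f`. [folklore] -/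
theorem trace_twin_pow {ι : Type*} [Fintype ι] [DecidableEq ι] {n : ℕ}
    (L : Matrix (Fin w) (Fin w) (MvPolynomial σ k)) (M : Matrix ι ι (MvPolynomial σ k))
    (f : MvPolynomial σ k) {ζ c : k} (hζ : ζ ^ n = -1) (hc : c ^ n * n = 1)
    (htrace : (M ^ n).trace = (L ^ n).trace + n * f) :
    ((c • Matrix.fromBlocks M 0 0 (ζ • L)) ^ n).trace = f := by
  rw [smul_pow, Matrix.fromBlocks_diagonal_pow, Matrix.trace_smul]
  have hsplit : (Matrix.fromBlocks (M ^ n) 0 0 ((ζ • L) ^ n)).trace =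
      (M ^ n).trace + ((ζ • L) ^ n).trace := by
    simp [Matrix.trace, Fintype.sum_sum_type]
  rw [hsplit, htrace, smul_pow, Matrix.trace_smul, hζ]
  have h1 : (L ^ n).trace + (n : MvPolynomial σ k) * f + (-1 : k) • (L ^ n).trace =
      (n : MvPolynomial σ k) * f := by
    rw [neg_one_smul]
    abel
  rw [h1, MvPolynomial.smul_eq_C_mul, ← mul_assoc, ← map_natCast (C : k →+* MvPolynomial σ k) n,
    ← map_mul, hc, map_one, one_mul]

/-- Reindexing along `Fin m ≃ ι` turns a matrix `T` on `ι` with homogeneous linear entries and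
`tr(Tⁿ) = f` into a witness of `HasPowTraceRepr K f n m` (powers and traces commute with
reindexing). [folklore] -/
theorem hasPowTraceRepr_of_equiv {K : Type*} [Field K] {τ ι : Type*} [Fintype ι] [DecidableEq ι]
    {f : MvPolynomial τ K} {n m : ℕ} (e : Fin m ≃ ι) (T : Matrix ι ι (MvPolynomial τ K))
    (hT : ∀ i j, (T i j).IsHomogeneous 1) (htr : (T ^ n).trace = f) :
    HasPowTraceRepr K f n m := by
  refine ⟨T.submatrix e e, fun i j => ?_, ?_⟩
  · rw [Matrix.submatrix_apply]
    exact hT (e i) (e j)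
  · rw [Literature.Barriers.ValiantsHypothesis.Grenet.submatrix_pow_equiv,
      Literature.Barriers.ValiantsHypothesis.Grenet.trace_submatrix_equiv, htr]

end Twin

end TraceUnrolling

/-- **Stub S2 `stub_traceUnrolling` (linear homogenisation / the `ζ`-twin) of line
`linear-homogenisation-transfer`.**  Let `n ≥ 2` and let `ρ, γ ∈ (S¹)^w`, `L ∈ M_w(S¹)` be
homogeneous linear over `S = ℂ[σ]` with `ρᵀ L^{n-2} γ = f` and `ρᵀ Lʲ γ = 0` for `j < n - 2`.
Then `f = tr(𝕄ⁿ)` for a `(2w+1) × (2w+1)` matrix `𝕄` of homogeneous linear forms, namely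
`𝕄 = c · ([[0, ρᵀ], [γ, L]] ⊕ ζ L)` with `ζⁿ = -1`, `cⁿ = 1/n`, reindexed to `Fin (2w+1)`:
by the closed-walk identity `tr([[0, ρᵀ], [γ, L]]ⁿ) = tr(Lⁿ) + n · ρᵀ L^{n-2} γ`
(`TraceUnrolling.trace_bordered_pow`). [folklore] -/
theorem stub_traceUnrolling :
    ∀ (σ : Type) (n w : ℕ) (f : MvPolynomial σ ℂ) (ρ γ : Fin w → MvPolynomial σ ℂ)
      (L : Matrix (Fin w) (Fin w) (MvPolynomial σ ℂ)),
      2 ≤ n → (∀ i, (ρ i).IsHomogeneous 1) → (∀ i, (γ i).IsHomogeneous 1) →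
      (∀ i j, (L i j).IsHomogeneous 1) → ρ ⬝ᵥ ((L ^ (n - 2)) *ᵥ γ) = f →
      (∀ j : ℕ, j < n - 2 → ρ ⬝ᵥ ((L ^ j) *ᵥ γ) = 0) →
      HasPowTraceRepr ℂ f n (2 * w + 1) := by
  intro σ n w f ρ γ L hn hρ hγ hL hA3 hA2
  have hvan : ∀ j : ℕ, j + 2 < n → ρ ⬝ᵥ (L ^ j *ᵥ γ) = 0 := fun j hj => hA2 j (by omega)
  -- the bordered matrix and the closed-walk identity
  set M : Matrix (Unit ⊕ Fin w) (Unit ⊕ Fin w) (MvPolynomial σ ℂ) :=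
    Matrix.fromBlocks 0 (replicateRow Unit ρ) (replicateCol Unit γ) L with hM
  have htrace := TraceUnrolling.trace_bordered_pow hM hn hvan
  rw [hA3] at htrace
  -- roots of unity / scaling constants
  obtain ⟨ζ, hζ⟩ := IsAlgClosed.exists_pow_nat_eq (-1 : ℂ) (by omega : 0 < n)
  obtain ⟨c, hc⟩ := IsAlgClosed.exists_pow_nat_eq ((n : ℂ)⁻¹) (by omega : 0 < n)
  have hc' : c ^ n * n = 1 := by
    rw [hc]
    exact inv_mul_cancel₀ (by exact_mod_cast (show n ≠ 0 by omega))
  -- reindex the twin `c • (M ⊕ ζ L)` to `Fin (2w+1)`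
  have hcard : Fintype.card ((Unit ⊕ Fin w) ⊕ Fin w) = 2 * w + 1 := by
    simp only [Fintype.card_sum, Fintype.card_unit, Fintype.card_fin]
    ring
  exact TraceUnrolling.hasPowTraceRepr_of_equiv (Fintype.equivFinOfCardEq hcard).symm
    (c • Matrix.fromBlocks M 0 0 (ζ • L))
    (TraceUnrolling.twin_isHomogeneous hM hρ hγ hL ζ c)
    (TraceUnrolling.trace_twin_pow L M f hζ hc' htrace)

end Summit.ValiantsHypothesis.ValiantsHypothesis.Theorems.DetQPDetqpSuperquadratic
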